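import Summits.QuantumAdvantage.QuantumAdvantage.Theorems.CubicForrelationNearExactIsExactTwoModSixSecondLevelThree
import Summits.QuantumAdvantage.QuantumAdvantage.Theorems.CubicForrelationNearExactIsExactTwoModSixSecondLevelFour
import Summits.QuantumAdvantage.QuantumAdvantage.Theorems.CubicForrelationNearExactIsExactTwoModSixSecondHighLevels

/-!
# Crux `CubicForrelation.NearExactIsExact` (stmt-QuantumAdvantage-14043) — `n = 6r+2`, `r ≥ 4`: every level `≥ 2r+3` is EXACT at the
  second boundary (`W_g ∈ 2^{2r+3}ℤ ∧ Φ ≥ 1 − 2^{−2r} ⇒ Φ = 1`)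

Certificate seat `b2b-cforr-cert` (gen 9).  HONEST FRAMING: a theorem uniform in `r` about cubic Boolean pairs on `6r+2` bits, `r ≥ 4`
(`n = 26, 32, 38, …`): the complete LEVEL part of the case analysis of `Φ ≥ 1 − 2^{−⌊n/3⌋} ⇒ Φ = 1` on `n ≡ 2 (mod 6)` above the Ax base
and its first even level — NOT summit progress, and not the full boundary theorem (type O and level `2r+2` remain, as at `n = 14`).

Assembly (`tm2_second_levels_exact`): with `W_g = 2^{2r+3}·w`, either some `w` is odd (`tm2_levelThree_false`, codimension-3 flat), or
`W_g = 2^{2r+4}·w'` with some `w'` odd (`tm2_levelFour_false`, codimension-5 flat), or `W_g ∈ 2^{2r+5}ℤ` (`tm2_second_high_levels`, tower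
walk + Hou).  Instances: `isolation_twentysix_levels` (`n = 26`, `W_g ∈ 2¹¹ℤ ∧ Φ ≥ 255/256 ⇒ Φ = 1`).

References: as in the imported files.  Everything below is proved from Mathlib and the tree; axioms are the standard three.
-/

set_option linter.dupNamespace false -- D-0017: single-problem summit ⇒ `QuantumAdvantage.QuantumAdvantage` by design

noncomputable section

namespace Summit.QuantumAdvantage.QuantumAdvantage.Theorems.CubicForrelation.NearExactIsExact

open Finset
open Literature.Computability.QuantumComplexity
open Literature.Computability.QuantumComplexity.DerivativeWalsh (W)

/-- **Levels `≥ 2r+3` are exact at the second boundary on `6r+2` bits (`r ≥ 4`).**  For cubic `f, g : 𝔽₂^{(3r+1)+(3r+1)} → 𝔽₂` with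
`W_g = 2^{2r+3}·w` and `Φ(f,g) ≥ 1 − (1/2)^{2r}`: `Φ(f,g) = 1`.  Uniform in `r`; NOT summit progress. [this work] -/
theorem tm2_second_levels_exact (r : ℕ) (hr : 4 ≤ r) (f g : (Fin ((3 * r + 1) + (3 * r + 1)) → Bool) → Bool) (hf : IsDegLeFun 3 f)
    (hg : IsDegLeFun 3 g) (w : (Fin ((3 * r + 1) + (3 * r + 1)) → Bool) → ℤ)
    (hw : ∀ x, W (fun y => signOf (g y)) x = (2 : ℝ) ^ (2 * r + 3) * (w x : ℝ))
    (hΦ : 1 - (1 / 2 : ℝ) ^ (2 * r) ≤ forrelation f g) : forrelation f g = 1 := by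
  by_cases h3 : ∃ x, Odd (w x)
  · exact (tm2_levelThree_false r (by omega) f g hf hg w hw h3 hΦ).elim
  · push Not at h3
    have hw' := tw_level_up g w hw h3
    by_cases h4 : ∃ x, Odd (w x / 2)
    · exact (tm2_levelFour_false r hr f g hf hg (fun x => w x / 2) hw' h4 hΦ).elim
    · push Not at h4
      have hw'' := tw_level_up g (fun x => w x / 2) hw' h4
      exact tm2_second_high_levels r hr f g hf hg _ hw'' hΦ

/-- **Instance `n = 26`:** for cubic `f, g : 𝔽₂²⁶ → 𝔽₂` with `W_g ∈ 2¹¹ℤ` and `Φ(f,g) ≥ 255/256`, `Φ(f,g) = 1`.  Finite-slice statement; NOT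
summit progress. [this work] -/
theorem isolation_twentysix_levels (f g : (Fin (13 + 13) → Bool) → Bool) (hf : IsDegLeFun 3 f) (hg : IsDegLeFun 3 g)
    (w : (Fin (13 + 13) → Bool) → ℤ) (hw : ∀ x, W (fun y => signOf (g y)) x = (2 : ℝ) ^ 11 * (w x : ℝ))
    (hΦ : (255 / 256 : ℝ) ≤ forrelation f g) : forrelation f g = 1 :=
  tm2_second_levels_exact 4 le_rfl f g hf hg w hw (by norm_num; exact hΦ)

end Summit.QuantumAdvantage.QuantumAdvantage.Theorems.CubicForrelation.NearExactIsExact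

end
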